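import Summits.BirchSwinnertonDyer.Rank1Residual.Additive.TameBranchLambdaParityRankOne
import Summits.BirchSwinnertonDyer.Rank1Residual.Additive.TameBranchLambdaParityRankZero
import HarnessLib

/-!
# THE EQUALITY CASE IS A CERTIFICATE — the FULL squeeze on the tame branch: a BSD-side lower
# certificate meeting the analytic upper bound forces `λ(X) = λ_an` (ANY `λ_an`), `μ(X) = m`,
# `Ш(E/ℚ)[p^∞] = 0`, `ℓ_p = 1`, the regulator valuation, and the main conjecture AT THE PAIR
# (cell `b2b-bsdres`, sub-cell additive-p2 = X3♯(G-ord)/X4♯(G-ord), gen 31; part 1)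

HONEST FRAMING (cell `b2b-bsdres`, run/shared/lean/b2b/bsd-rank1-residual/, verbatim in every
file): the goal of the cell is to DELETE the COMBINATION-SHAPED residual classes of the
Birch–Swinnerton-Dyer formula for ALL analytic-rank `≤ 1` elliptic curves over `ℚ` — "full BSD
formula for every rank `≤ 1` curve in class `C`" assembled STRICTLY from published theorems — so
that the rank-`≤ 1` remainder becomes exactly the CONSTRUCTION-SHAPED classes, which are TYPED
(missing-input `Prop`s), NOT attempted. This is not "finishing BSD". Sub-cell additive-p2: the
classes X3♯(G-ord) / X4♯(G-ord) are CONSTRUCTION-SHAPED and stay so; labels / RESIDUAL-MAP marks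
UNCHANGED; nothing is booked. Theorems only (pure algebra of `Λ = ℤ_p⟦T⟧` and `p`-adic valuations;
the one published input is the hypothesis binder `LeadingTermClauses W p Dh` = Delbourgo 2002 (B) for a
given height datum); no definition, no named fact, no `sorry`.

## What and why

Gens 29–30 proved, per cyclotomic dual datum of `Sel_{p^∞}(E/ℚ_∞)` with generator `fE`, a RATIONAL
Kato half `ι g = p^k·B` (`g ∈ (fE)`, `B` bounded by `p^c` with FIRST TOP coefficient at `n = λ_an`)
and Delbourgo's (B)-clauses for a height datum `Dh`, the two-sided sandwich
`μ(fE) + r + 2t ≤ LHS ≤ μ(fE) + v_p([Tʳ]B) + c + r + 2t` (`r = rank ∈ {0,1}`, `t = ord_p #E(ℚ)_tors`,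
`LHS = ord_p #Ш[p^∞] + ord_p Reg_p(E,Dh) + ord_p ∏c + ord_p ℓ`), left `=` iff `λ(fE) = r`, right
`=` iff `λ(fE) = n`; and the PARITY squeeze, which at `n = r + 2` decides the λ-part. Gen 30 left
open the rows with `λ_an ≥ r + 4` ("a second squeeze needs a lower bound beating μ + the first extra
pair"). THIS FILE records that the needed lower bound is simply a BSD-side one MEETING THE UPPER
BOUND: if `μ(fE) ≤ m`, `v ≤ ord_p Reg_p(E,Dh)` and

  **`m + v_p([Tʳ]B) + c + r + 2t ≤ v + ord_p ∏c_ℓ`**  (the FULL squeeze; `r = 1`: §1, `r = 0`: §2)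

then the chain `LHS ≤ μ + v_p([Tʳ]B) + c + r + 2t ≤ m + … ≤ v + ord_p ∏c ≤ LHS` collapses and
EVERYTHING is decided at the pair, for ANY first top `n`, with NO parity input:
`λ(fE) = n` (the λ-part), `μ(fE) = m` (the μ-bound is SHARP), `#Ш(E/ℚ)[p^∞] = 1`,
`ord_p Reg_p(E,Dh) = v` EXACTLY, the coefficient identity `v_p([Tʳ]fE) = m + v_p([Tʳ]B) + c`, the
factor `ℓ` of (B) clause 3 is `1` for EVERY admissible `(u, ℓ)` (Delbourgo's `ℓ_p(E)`-proviso
discharged AT THE PAIR, anomalous or not), and `char_Λ X = (G)` with `ι G = p^{m+c}·B` — the main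
conjecture at the pair RATIONALLY, INTEGRALLY in E-normalisation iff `m = 0` (part 1 §2 of gen 30).
§0 supplies the two arithmetic facts (`p ∤ #Ш[p^∞] ⟹ #Ш[p^∞] = 1`; `ℓ ∣ p²`, `p ∤ ℓ ⟹ ℓ = 1`) and the
valuation of clause 3. Parts 2–4 of gen 31 apply this (a) on DEFECT 2, where the INTEGRAL Kato
divisibility makes `m = 0` a THEOREM from one unit coefficient (`TameBranchMuPartDefectTwo*`), and (b) on
defect 3, 4, 6 from PRINT + two values + one Riemann sum (`TameBranchFullSqueezeCertificate`).
Nothing booked; labels UNCHANGED.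

References: Delbourgo 2002 Thm. (B) p. 40 [Delbourgo2002]; Greenberg LNM 1716 §4 pp. 102–110 (the
shape "Kato + the BSD_p-data ⟹ main conjecture") [GreenbergLNM1716]; Greenberg–Vatsal 2000 p. 4
[GreenbergVatsal2000]; Washington GTM 83 §7.1 [Washington1997]; `TameBranchExtraZerosRankOne/RankZero.lean`
(gen 29), `TameBranchLambdaParityLaw.lean` (gen 30). -/

set_option autoImplicit false

noncomputable section

open scoped Classical MatrixGroups ModularForm NumberField

open CongruenceSubgroup IsDedekindDomain WeierstrassCurve NumberField
  Literature.NumberTheory.EllipticCurves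
  Literature.NumberTheory.EllipticCurves.ModularForms
  Literature.NumberTheory.EllipticCurves.Rank1Residual
  Literature.NumberTheory.EllipticCurves.Rank1Residual.Typed
  Literature.NumberTheory.EllipticCurves.Delbourgo2002
  Summit.BirchSwinnertonDyer.Rank1Residual.X1.MuLambda
  Summit.BirchSwinnertonDyer.Rank1Residual.X1.RankOneParitySqueeze
  Summit.BirchSwinnertonDyer.Rank1Residual.X11a.LambdaNorm

namespace Summit.BirchSwinnertonDyer.Rank1Residual.Additive

namespace TameBranchFullSqueeze

/-! ### §0 Arithmetic: `p ∤ #Ш[p^∞] ⟹ Ш[p^∞] = 0`, `ℓ ∣ p² ∧ p ∤ ℓ ⟹ ℓ = 1`, valuation of clause 3 -/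

section Arith

/-- A finite `p`-primary component of `p`-adic valuation `0` is TRIVIAL: every element has order
`pⁿ ∣ #A[p^∞]`, and `p ∤ #A[p^∞]` forces `n = 0`. [folklore] -/
theorem natCard_primaryComponent_eq_one_of_padicValNat_eq_zero {A : Type*} [AddCommGroup A]
    (p : ℕ) [hp : Fact p.Prime] [Finite (AddCommGroup.primaryComponent A p)]
    (h : padicValNat p (Nat.card (AddCommGroup.primaryComponent A p)) = 0) :
    Nat.card (AddCommGroup.primaryComponent A p) = 1 := by
  have hndvd : ¬ p ∣ Nat.card (AddCommGroup.primaryComponent A p) := by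
    rcases padicValNat.eq_zero_iff.mp h with h1 | h0 | hnd
    · exact absurd h1 hp.out.one_lt.ne'
    · exact absurd h0 Nat.card_pos.ne'
    · exact hnd
  have key : ∀ z : AddCommGroup.primaryComponent A p, z = 0 := by
    intro z
    obtain ⟨n, hn⟩ := (AddCommGroup.mem_primaryComponent_iff_addOrderOf (p := p)).mp z.2
    have hdvd : addOrderOf z ∣ Nat.card (AddCommGroup.primaryComponent A p) :=
      addOrderOf_dvd_natCard z
    rw [← AddSubgroup.addOrderOf_coe, hn] at hdvd
    rcases n with _ | k
    · rw [pow_zero, AddMonoid.addOrderOf_eq_one_iff] at hn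
      exact Subtype.ext hn
    · exact absurd (dvd_trans (dvd_pow_self p k.succ_ne_zero) hdvd) hndvd
  haveI : Subsingleton (AddCommGroup.primaryComponent A p) := ⟨fun x y ↦ by rw [key x, key y]⟩
  exact Nat.card_of_subsingleton (0 : AddCommGroup.primaryComponent A p)

/-- `ℓ ∣ p²` and `ord_p ℓ = 0` force `ℓ = 1` (`ℓ ∈ {1, p, p²}`). [folklore] -/
theorem eq_one_of_dvd_prime_sq_of_padicValNat_eq_zero {p : ℕ} [hp : Fact p.Prime] {ℓ : ℕ}
    (hℓ : ℓ ∣ p ^ 2) (h : padicValNat p ℓ = 0) : ℓ = 1 := by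
  obtain ⟨i, -, rfl⟩ := (Nat.dvd_prime_pow hp.out).mp hℓ
  rw [padicValNat.prime_pow] at h
  rw [h, pow_zero]

variable {W : WeierstrassCurve ℚ} [W.IsElliptic] {p : ℕ} [hp : Fact p.Prime]

/-- **Valuations of the two sides of Delbourgo's clause 3** `x·log_p(γ)^r·#tors² = u·ℓ·(S·R·∏c)`
(`x = [Tʳ]fE ≠ 0`, `R = Reg_p ≠ 0`, `S = #Ш[p^∞] ≠ 0`, `ℓ ≠ 0`, `u ∈ ℤ_p^×`, `p` odd so that
`ord_p log_p(γ_cyc) = 1`): `v_p(x) + r + 2 ord_p #tors = ord_p ℓ + ord_p S + v_p(R) + ord_p ∏c`.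
[cite: Delbourgo2002, Theorem (B) (p. 40)] -/
theorem valuation_eq_of_clause_three (hp2 : p ≠ 2) {r : ℕ} {x R : ℚ_[p]} (hx : x ≠ 0) (hR : R ≠ 0)
    {u : ℤ_[p]ˣ} {ℓ S : ℕ} (hℓ : ℓ ≠ 0) (hS : S ≠ 0)
    (heq : x * padicLog p (cyclotomicGenerator p) ^ r * (W.torsionOrder : ℚ_[p]) ^ 2 =
      ((u : ℤ_[p]) : ℚ_[p]) * (ℓ : ℚ_[p]) * ((S : ℚ_[p]) * R * (W.tamagawaProduct : ℚ_[p]))) :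
    x.valuation + r + 2 * (padicValNat p W.torsionOrder : ℤ) =
      (padicValNat p ℓ : ℤ) + ((padicValNat p S : ℤ) + R.valuation + padicValNat p W.tamagawaProduct) := by
  have hpQ : (p : ℚ_[p]) ≠ 0 := Nat.cast_ne_zero.mpr hp.out.ne_zero
  obtain ⟨w, hw⟩ := exists_unit_padicLog_cyclotomicGenerator (p := p) hp2
  have hlog0 : padicLog p (cyclotomicGenerator p : ℚ_[p]) ≠ 0 := by
    rw [hw]; exact mul_ne_zero hpQ (coe_units_ne_zero p w)
  have hlogv : (padicLog p (cyclotomicGenerator p : ℚ_[p])).valuation = 1 := by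
    rw [hw, Padic.valuation_mul hpQ (coe_units_ne_zero p w), Padic.valuation_p,
      valuation_coe_units_eq_zero, add_zero]
  have hTQ : (W.torsionOrder : ℚ_[p]) ≠ 0 := by exact_mod_cast (W.torsionOrder_pos_holds).ne'
  have hu0 : ((u : ℤ_[p]) : ℚ_[p]) ≠ 0 := coe_units_ne_zero p u
  have hℓQ : (ℓ : ℚ_[p]) ≠ 0 := by exact_mod_cast hℓ
  have hSQ : (S : ℚ_[p]) ≠ 0 := by exact_mod_cast hS
  have hCc0 : (W.tamagawaProduct : ℚ_[p]) ≠ 0 := by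
    exact_mod_cast (W.tamagawaProduct_pos_holds : 0 < W.tamagawaProduct).ne'
  have hval := congrArg Padic.valuation heq
  rw [Padic.valuation_mul (mul_ne_zero hx (pow_ne_zero r hlog0)) (pow_ne_zero 2 hTQ),
    Padic.valuation_mul hx (pow_ne_zero r hlog0), Padic.valuation_pow, Padic.valuation_pow, hlogv,
    Padic.valuation_natCast,
    Padic.valuation_mul (mul_ne_zero hu0 hℓQ) (mul_ne_zero (mul_ne_zero hSQ hR) hCc0),
    Padic.valuation_mul hu0 hℓQ, valuation_coe_units_eq_zero, zero_add, Padic.valuation_natCast,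
    Padic.valuation_mul (mul_ne_zero hSQ hR) hCc0, Padic.valuation_mul hSQ hR,
    Padic.valuation_natCast, Padic.valuation_natCast] at hval
  simp only [Nat.cast_ofNat, mul_one] at hval
  linarith

end Arith

/-! ### §1 Rank one: the FULL squeeze, per cyclotomic datum -/

section RankOne

open TameBranchExtraZeros TameBranchLambdaParity

variable {W : WeierstrassCurve ℚ} [W.IsElliptic] {p : ℕ} [hp : Fact p.Prime]

/-- **THE FULL SQUEEZE AT RANK ONE (per cyclotomic datum; no parity input).** `p ≠ 2`,
`rank_ℤ E(ℚ) = 1`, a (B)-datum `Dh`, a cyclotomic dual datum `D` with `X` torsion and generator `fE`,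
`g ∈ char_Λ X` with `ι g = p^k·B`, `‖[Tʲ]B‖ ≤ p^c` with FIRST TOP at `n` (`= λ_an`, ANY `n`),
`[T¹]B ≠ 0`; a certified `μ`-bound `μ(fE) ≤ m` and a certified regulator bound `v ≤ ord_p Reg_p(E,Dh)`
with **`m + v_p([T¹]B) + c + 1 + 2·ord_p #E(ℚ)_tors ≤ v + ord_p ∏c_ℓ`**. Then: Schneider;
**`λ(fE) = n`** (the λ-part of the main conjecture at the pair); **`μ(fE) = m`**; **`#Ш(E/ℚ)[p^∞] = 1`**;
**`ord_p Reg_p(E,Dh) = v`**; `v_p([T¹]fE) = m + v_p([T¹]B) + c`; **every `(u, ℓ)` fitting clause 3 of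
(B) has `ℓ = 1`**; and **`char_Λ X = (G)` with `ι G = p^{m+c}·B`** (INTEGRAL in E-normalisation iff
`m = 0`). Greenberg's "Kato's theorem + the `p`-part of the BSD data ⟹ the main conjecture", in the
tame-branch currency, as a per-pair certificate. [cite: Delbourgo2002, Theorem (B) (p. 40)]
[cite: GreenbergLNM1716, §4 pp. 102–110] [cite: GreenbergVatsal2000, p. 4] [cite: Washington1997, §7.1] -/
theorem fullSqueeze_rankOne_of_iota_eq_of_firstTop (hp2 : p ≠ 2)
    (hr1 : W.mordellWeilRank = 1) {Dh : PAdicHeightData W p} (hBcl : LeadingTermClauses W p Dh)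
    {κ : ZpExtension ℚ p} {γ : Field.absoluteGaloisGroup ℚ}
    (hκ : κ.IsCyclotomic) (hγ : κ.IsTopGenerator γ) (hγ' : IsCyclotomicVariable p γ)
    (D : W.SelmerDualData κ γ) [Module.Finite (IwasawaAlgebra p) D.X] (hX : D.IsTorsion)
    {fE g : IwasawaAlgebra p} (hchar : D.charIdeal = Ideal.span {fE}) (hg : g ∈ D.charIdeal)
    {k c : ℕ} {B : PowerSeries ℚ_[p]}
    (hι : iwasawaToPowerSeries p g = PowerSeries.C ((p : ℚ_[p]) ^ k) * B)
    (hbd : ∀ j : ℕ, ‖PowerSeries.coeff j B‖ ≤ (p : ℝ) ^ c)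
    {n : ℕ} (hn : ‖PowerSeries.coeff n B‖ = (p : ℝ) ^ c)
    (hlt : ∀ i < n, ‖PowerSeries.coeff i B‖ < (p : ℝ) ^ c) (hB1 : PowerSeries.coeff 1 B ≠ 0)
    {m : ℕ} (hμ : mu fE ≤ m) {v : ℤ} (hv : v ≤ (padicRegulator Dh).valuation)
    (hfull : (m : ℤ) + (PowerSeries.coeff 1 B).valuation + c + 1 + 2 * padicValNat p W.torsionOrder ≤
      v + padicValNat p W.tamagawaProduct) :
    SchneiderConjecture Dh ∧ lam fE = n ∧ mu fE = m ∧
      Nat.card (AddCommGroup.primaryComponent W.sha p) = 1 ∧ (padicRegulator Dh).valuation = v ∧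
      (((PowerSeries.coeff 1 fE : ℤ_[p]) : ℚ_[p])).valuation =
        m + (PowerSeries.coeff 1 B).valuation + c ∧
      (∀ (u : ℤ_[p]ˣ) (ℓ : ℕ), ℓ ∣ p ^ 2 →
        ((PowerSeries.coeff W.mordellWeilRank fE : ℤ_[p]) : ℚ_[p]) *
            padicLog p (cyclotomicGenerator p) ^ W.mordellWeilRank * (W.torsionOrder : ℚ_[p]) ^ 2 =
          ((u : ℤ_[p]) : ℚ_[p]) * (ℓ : ℚ_[p]) *
            ((Nat.card (AddCommGroup.primaryComponent W.sha p) : ℚ_[p]) *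
              padicRegulator Dh * W.tamagawaProduct) → ℓ = 1) ∧
      ∃ G : IwasawaAlgebra p, D.charIdeal = Ideal.span {G} ∧ mu G = m ∧ lam G = n ∧
        iwasawaToPowerSeries p G = PowerSeries.C ((p : ℚ_[p]) ^ (m + c)) * B := by
  have hpQ : (p : ℚ_[p]) ≠ 0 := Nat.cast_ne_zero.mpr hp.out.ne_zero
  obtain ⟨hS, hfin, -, -, ℓ, -, -, hle, hiff⟩ :=
    schneider_and_padicVal_le_rankOne_of_iota_eq_of_firstTop hp2 hr1 hBcl hκ hγ hγ' D hX hchar hg hι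
      hbd hn hlt hB1
  haveI : Finite (AddCommGroup.primaryComponent W.sha p) := hfin
  have hSh : (0 : ℤ) ≤ padicValNat p (Nat.card (AddCommGroup.primaryComponent W.sha p)) := by
    exact_mod_cast Nat.zero_le _
  have hℓv : (0 : ℤ) ≤ padicValNat p ℓ := by exact_mod_cast Nat.zero_le _
  have hμ' : (mu fE : ℤ) ≤ m := by exact_mod_cast hμ
  -- the chain collapses
  have hlamn : lam fE = n := hiff.mp (by linarith)
  have hμm : mu fE = m := by
    have h1 : (m : ℤ) ≤ mu fE := by linarith
    have h2 : m ≤ mu fE := by exact_mod_cast h1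
    omega
  have hSh0 : padicValNat p (Nat.card (AddCommGroup.primaryComponent W.sha p)) = 0 := by
    have h1 : (padicValNat p (Nat.card (AddCommGroup.primaryComponent W.sha p)) : ℤ) ≤ 0 := by
      linarith
    omega
  have hcard : Nat.card (AddCommGroup.primaryComponent W.sha p) = 1 :=
    natCard_primaryComponent_eq_one_of_padicValNat_eq_zero p hSh0
  have hRegv : (padicRegulator Dh).valuation = v := by linarith
  -- the factorisation and the coefficient identity (gen 29's equality case)
  have hg' := hg
  rw [hchar] at hg'
  obtain ⟨h, hh⟩ := Ideal.mem_span_singleton'.mp hg'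
  have hfac : g = fE * h := by rw [← hh, mul_comm]
  have hcl := hBcl κ γ hκ hγ hγ' D hX fE hchar
  have hord1 : (1 : ℕ∞) ≤ fE.order := by
    have h1 := hcl.1
    rwa [hr1, Nat.cast_one] at h1
  have hf0 : PowerSeries.constantCoeff fE = 0 := by
    rw [← PowerSeries.coeff_zero_eq_constantCoeff_apply]
    exact PowerSeries.coeff_of_lt_order 0 (lt_of_lt_of_le (by exact_mod_cast Nat.zero_lt_one) hord1)
  have hg0 : g ≠ 0 := by
    intro h0
    have : ((PowerSeries.coeff 1 g : ℤ_[p]) : ℚ_[p]) = (p : ℚ_[p]) ^ k * PowerSeries.coeff 1 B := by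
      rw [← Wuthrich2014.coeff_iwasawaToPowerSeries p g 1, hι, PowerSeries.coeff_C_mul]
    rw [h0] at this
    simp only [map_zero, PadicInt.coe_zero] at this
    exact (mul_ne_zero (pow_ne_zero _ hpQ) hB1) this.symm
  have hlamg : lam g = n := lam_eq_of_iota_eq_of_firstTop hg0 hι hbd hn hlt
  have hlameq : lam fE = lam g := by rw [hlamn, hlamg]
  obtain ⟨hf1, -⟩ := valuation_coeff_one_le hfac hι hbd hf0 hB1
  have hcoef : (((PowerSeries.coeff 1 fE : ℤ_[p]) : ℚ_[p])).valuation =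
      m + (PowerSeries.coeff 1 B).valuation + c := by
    rw [← hμm]
    exact (valuation_coeff_one_eq_iff hfac hι hbd hn hf0 hB1).mpr hlameq
  -- every admissible `ℓ` is `1`
  have hℓone : ∀ (u : ℤ_[p]ˣ) (ℓ : ℕ), ℓ ∣ p ^ 2 →
      ((PowerSeries.coeff W.mordellWeilRank fE : ℤ_[p]) : ℚ_[p]) *
          padicLog p (cyclotomicGenerator p) ^ W.mordellWeilRank * (W.torsionOrder : ℚ_[p]) ^ 2 =
        ((u : ℤ_[p]) : ℚ_[p]) * (ℓ : ℚ_[p]) *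
          ((Nat.card (AddCommGroup.primaryComponent W.sha p) : ℚ_[p]) *
            padicRegulator Dh * W.tamagawaProduct) → ℓ = 1 := by
    intro u ℓ' hℓ'p heq
    rw [hr1] at heq
    have hℓ'0 : ℓ' ≠ 0 := by
      rintro rfl
      exact hp.out.ne_zero (pow_eq_zero_iff (n := 2) (by norm_num) |>.mp (zero_dvd_iff.mp hℓ'p))
    have hval := valuation_eq_of_clause_three (W := W) hp2 hf1 hS hℓ'0
      (Nat.card_pos (α := AddCommGroup.primaryComponent W.sha p)).ne' heq
    rw [hcoef, hcard, hRegv, padicValNat_one_right] at hval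
    simp only [Nat.cast_one, Nat.cast_zero, zero_add] at hval
    have hℓ'v : (padicValNat p ℓ' : ℤ) ≤ 0 := by linarith
    have hℓ'z : padicValNat p ℓ' = 0 := by omega
    exact eq_one_of_dvd_prime_sq_of_padicValNat_eq_zero hℓ'p hℓ'z
  -- the main conjecture at the pair, exponent `m + c`
  obtain ⟨-, hspan, hμG, hlamG, -⟩ := exists_span_eq_and_iota_eq_zpow_of_lam_eq hfac hg0 hι hlameq
  obtain ⟨-, hιG⟩ := iota_eq_pow_mu_add_of_lam_eq hfac hg0 hι hbd hn hlameq
  refine ⟨hS, hlamn, hμm, hcard, hRegv, hcoef, hℓone, fE * pfree h, by rw [hchar, hspan],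
    by rw [hμG, hμm], by rw [hlamG, hlamn], ?_⟩
  rw [hιG, hμm]

end RankOne

/-! ### §2 Rank zero: the FULL squeeze, per cyclotomic datum -/

section RankZero

open TameBranchExtraZeros TameBranchLambdaParity

variable {W : WeierstrassCurve ℚ} [W.IsElliptic] {p : ℕ} [hp : Fact p.Prime]

/-- **THE FULL SQUEEZE AT RANK ZERO (per cyclotomic datum; no parity input).** `p ≠ 2`,
`rank_ℤ E(ℚ) = 0`, a (B)-datum `Dh` (`Reg_p = 1`), a cyclotomic dual datum `D` with `X` torsion and
generator `fE`, `g ∈ char_Λ X` with `ι g = p^k·B`, `‖[Tʲ]B‖ ≤ p^c` with FIRST TOP at `n` (ANY `n`),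
`B(0) ≠ 0`; a certified `μ(fE) ≤ m` with **`m + v_p(B(0)) + c + 2·ord_p #E(ℚ)_tors ≤ ord_p ∏c_ℓ`**.
Then **`λ(fE) = n`**, **`μ(fE) = m`**, **`#Ш(E/ℚ)[p^∞] = 1`**, `v_p(fE(0)) = m + v_p(B(0)) + c`,
**every `(u, ℓ)` fitting clause 3 of (B) has `ℓ = 1`**, and **`char_Λ X = (G)` with `ι G = p^{m+c}·B`**.
[cite: Delbourgo2002, Theorem (B) (p. 40)] [cite: GreenbergLNM1716, §4 pp. 102–110]
[cite: GreenbergVatsal2000, p. 4] [cite: Washington1997, §7.1] -/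
theorem fullSqueeze_rankZero_of_iota_eq_of_firstTop (hp2 : p ≠ 2)
    (hr0 : W.mordellWeilRank = 0) {Dh : PAdicHeightData W p} (hBcl : LeadingTermClauses W p Dh)
    {κ : ZpExtension ℚ p} {γ : Field.absoluteGaloisGroup ℚ}
    (hκ : κ.IsCyclotomic) (hγ : κ.IsTopGenerator γ) (hγ' : IsCyclotomicVariable p γ)
    (D : W.SelmerDualData κ γ) [Module.Finite (IwasawaAlgebra p) D.X] (hX : D.IsTorsion)
    {fE g : IwasawaAlgebra p} (hchar : D.charIdeal = Ideal.span {fE}) (hg : g ∈ D.charIdeal)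
    {k c : ℕ} {B : PowerSeries ℚ_[p]}
    (hι : iwasawaToPowerSeries p g = PowerSeries.C ((p : ℚ_[p]) ^ k) * B)
    (hbd : ∀ j : ℕ, ‖PowerSeries.coeff j B‖ ≤ (p : ℝ) ^ c)
    {n : ℕ} (hn : ‖PowerSeries.coeff n B‖ = (p : ℝ) ^ c)
    (hlt : ∀ i < n, ‖PowerSeries.coeff i B‖ < (p : ℝ) ^ c) (hB0 : PowerSeries.constantCoeff B ≠ 0)
    {m : ℕ} (hμ : mu fE ≤ m)
    (hfull : (m : ℤ) + (PowerSeries.constantCoeff B).valuation + c + 2 * padicValNat p W.torsionOrder ≤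
      padicValNat p W.tamagawaProduct) :
    lam fE = n ∧ mu fE = m ∧ Nat.card (AddCommGroup.primaryComponent W.sha p) = 1 ∧
      (((PowerSeries.constantCoeff fE : ℤ_[p]) : ℚ_[p])).valuation =
        m + (PowerSeries.constantCoeff B).valuation + c ∧
      (∀ (u : ℤ_[p]ˣ) (ℓ : ℕ), ℓ ∣ p ^ 2 →
        ((PowerSeries.coeff W.mordellWeilRank fE : ℤ_[p]) : ℚ_[p]) *
            padicLog p (cyclotomicGenerator p) ^ W.mordellWeilRank * (W.torsionOrder : ℚ_[p]) ^ 2 =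
          ((u : ℤ_[p]) : ℚ_[p]) * (ℓ : ℚ_[p]) *
            ((Nat.card (AddCommGroup.primaryComponent W.sha p) : ℚ_[p]) *
              padicRegulator Dh * W.tamagawaProduct) → ℓ = 1) ∧
      ∃ G : IwasawaAlgebra p, D.charIdeal = Ideal.span {G} ∧ mu G = m ∧ lam G = n ∧
        iwasawaToPowerSeries p G = PowerSeries.C ((p : ℚ_[p]) ^ (m + c)) * B := by
  have hpQ : (p : ℚ_[p]) ≠ 0 := Nat.cast_ne_zero.mpr hp.out.ne_zero
  obtain ⟨hS, hfin, ℓ, -, -, hle, hrest⟩ :=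
    schneider_and_padicVal_le_rankZero_of_iota_eq hr0 hBcl hκ hγ hγ' D hX hchar hg hι hbd hB0
  obtain ⟨-, hiff⟩ := hrest n hn hlt
  haveI : Finite (AddCommGroup.primaryComponent W.sha p) := hfin
  haveI : Finite W.toAffine.Point := W.mordellWeilRank_eq_zero_iff_finite.mp hr0
  have hReg1 : padicRegulator Dh = 1 := padicRegulator_eq_one_of_finite W p Dh
  have hReg : (padicRegulator Dh).valuation = 0 := by rw [hReg1, Padic.valuation_one]
  have hSh : (0 : ℤ) ≤ padicValNat p (Nat.card (AddCommGroup.primaryComponent W.sha p)) := by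
    exact_mod_cast Nat.zero_le _
  have hℓv : (0 : ℤ) ≤ padicValNat p ℓ := by exact_mod_cast Nat.zero_le _
  have hμ' : (mu fE : ℤ) ≤ m := by exact_mod_cast hμ
  rw [hReg] at hle hiff
  -- the chain collapses
  have hlamn : lam fE = n := hiff.mp (by linarith)
  have hμm : mu fE = m := by
    have h1 : (m : ℤ) ≤ mu fE := by linarith
    have h2 : m ≤ mu fE := by exact_mod_cast h1
    omega
  have hSh0 : padicValNat p (Nat.card (AddCommGroup.primaryComponent W.sha p)) = 0 := by
    have h1 : (padicValNat p (Nat.card (AddCommGroup.primaryComponent W.sha p)) : ℤ) ≤ 0 := by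
      linarith
    omega
  have hcard : Nat.card (AddCommGroup.primaryComponent W.sha p) = 1 :=
    natCard_primaryComponent_eq_one_of_padicValNat_eq_zero p hSh0
  -- the factorisation and the coefficient identity (gen 29's equality case)
  have hg' := hg
  rw [hchar] at hg'
  obtain ⟨h, hh⟩ := Ideal.mem_span_singleton'.mp hg'
  have hfac : g = fE * h := by rw [← hh, mul_comm]
  obtain ⟨hf0, -, hiffn⟩ := valuation_constantCoeff_le hfac hι hbd hB0
  have hg0 : g ≠ 0 := by
    intro h0
    have e : ((PowerSeries.constantCoeff g : ℤ_[p]) : ℚ_[p]) =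
        (p : ℚ_[p]) ^ k * PowerSeries.constantCoeff B := by
      rw [← constantCoeff_iwasawaToPowerSeries p g, hι, map_mul, PowerSeries.constantCoeff_C]
    rw [h0] at e
    simp only [map_zero, PadicInt.coe_zero] at e
    exact (mul_ne_zero (pow_ne_zero _ hpQ) hB0) e.symm
  have hlamg : lam g = n := lam_eq_of_iota_eq_of_firstTop hg0 hι hbd hn hlt
  have hlameq : lam fE = lam g := by rw [hlamn, hlamg]
  have hcoef : (((PowerSeries.constantCoeff fE : ℤ_[p]) : ℚ_[p])).valuation =
      m + (PowerSeries.constantCoeff B).valuation + c := by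
    rw [← hμm]
    exact (hiffn n hn).mpr hlameq
  -- every admissible `ℓ` is `1`
  have hℓone : ∀ (u : ℤ_[p]ˣ) (ℓ : ℕ), ℓ ∣ p ^ 2 →
      ((PowerSeries.coeff W.mordellWeilRank fE : ℤ_[p]) : ℚ_[p]) *
          padicLog p (cyclotomicGenerator p) ^ W.mordellWeilRank * (W.torsionOrder : ℚ_[p]) ^ 2 =
        ((u : ℤ_[p]) : ℚ_[p]) * (ℓ : ℚ_[p]) *
          ((Nat.card (AddCommGroup.primaryComponent W.sha p) : ℚ_[p]) *
            padicRegulator Dh * W.tamagawaProduct) → ℓ = 1 := by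
    intro u ℓ' hℓ'p heq
    rw [hr0, PowerSeries.coeff_zero_eq_constantCoeff] at heq
    have hℓ'0 : ℓ' ≠ 0 := by
      rintro rfl
      exact hp.out.ne_zero (pow_eq_zero_iff (n := 2) (by norm_num) |>.mp (zero_dvd_iff.mp hℓ'p))
    have hval := valuation_eq_of_clause_three (W := W) hp2 hf0 hS hℓ'0
      (Nat.card_pos (α := AddCommGroup.primaryComponent W.sha p)).ne' heq
    rw [hcoef, hcard, hReg, padicValNat_one_right] at hval
    simp only [Nat.cast_zero, add_zero, zero_add] at hval
    have hℓ'v : (padicValNat p ℓ' : ℤ) ≤ 0 := by linarith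
    have hℓ'z : padicValNat p ℓ' = 0 := by omega
    exact eq_one_of_dvd_prime_sq_of_padicValNat_eq_zero hℓ'p hℓ'z
  -- the main conjecture at the pair, exponent `m + c`
  obtain ⟨-, hspan, hμG, hlamG, -⟩ := exists_span_eq_and_iota_eq_zpow_of_lam_eq hfac hg0 hι hlameq
  obtain ⟨-, hιG⟩ := iota_eq_pow_mu_add_of_lam_eq hfac hg0 hι hbd hn hlameq
  refine ⟨hlamn, hμm, hcard, hcoef, hℓone, fE * pfree h, by rw [hchar, hspan], by rw [hμG, hμm],
    by rw [hlamG, hlamn], ?_⟩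
  rw [hιG, hμm]

end RankZero

end TameBranchFullSqueeze

end Summit.BirchSwinnertonDyer.Rank1Residual.Additive

end
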